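import Mathlib.MeasureTheory.Constructions.HaarToSphere
import Mathlib.MeasureTheory.Constructions.Pi
import Mathlib.MeasureTheory.Measure.Tilted
import Mathlib.MeasureTheory.Measure.Haar.InnerProductSpace
import Mathlib.Analysis.InnerProductSpace.PiL2
import Mathlib.MeasureTheory.Function.SpecialFunctions.Inner
import Literature.Probability.LatticeModels.LatticeGraph
import Literature.Probability.LatticeModels.Correlations
import Literature.Probability.LatticeModels.GibbsSpecification
import HarnessLib

-- provenance: harness21/H21/H21/Prelude/StatMech/ONModel.lean @ 93aad00 (interim HEAD d8f2665); M5 mechanical rewrite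
/-!
# The classical O(N) (N-vector) model on a graph

Trunk G02 (T-STATMECH), prelude item P18 `ONModel` (notion `on_sigma_model_lattice`).

For a locally finite simple graph `G` on `V`, a finite volume `Λ : Finset V`, an inverse
temperature `β` and a boundary condition `bc` (free, or fixed to a configuration `η` outside `Λ`)
we define the finite-volume Gibbs measure of the classical O(N) model (N-vector model, `N = 1`
Ising, `N = 2` XY / plane rotator, `N = 3` classical Heisenberg): spins `s_x` take values in the
unit sphere `𝕊^{N-1} ⊆ ℝ^N`, the a priori measure is the uniform (normalised surface) measure and
the Hamiltonian is `H_Λ^{bc}(s) = -∑_{{x,y}} ⟪s_x, s_y⟫` (Friedli–Velenik 2017, Ch. 9, eq. (9.2);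
Simon, *Fifteen problems in mathematical physics*, Problem 5, for context on the `N ≥ 2`
mass-gap problem).

## Design

* `SphereSpin N := Metric.sphere (0 : EuclideanSpace ℝ (Fin N)) 1` with the subtype Borel
  σ-algebra; `sphereUniform N` is Mathlib's `Measure.toSphere` of Lebesgue measure, normalised to
  total mass one. For `N = 0` the sphere is empty and `sphereUniform 0 = 0` (documented junk).
* `ONConfig V N := V → SphereSpin N`; boundary conditions `ONBoundary V N` are `free | fixed η` as
  in `IsingModel`; `onGlue` is `glueWith` (from `GibbsSpecification`) with `bc.outside`.
* The Hamiltonian follows the Friedli–Velenik convention of `IsingModel`: a bc-dependent edge set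
  `ONBoundary.interactionEdges` (`edgesIn` for free, `edgesTouching` for fixed), no separate
  boundary term.
* The Gibbs measure is `Measure.tilted` of the pushed-forward product reference measure
  (outline D3'). All bc-dependent constructions carry `[NeZero N]` (for `N = 0` and nonempty
  `V` there are no configurations, so no `outside` configuration exists); with it
  `sphereUniform N` is a probability measure by a real proof and `isProbabilityMeasure_onMeasure`
  is a real proof via `isProbabilityMeasure_tilted` (bounded Hamiltonian), registered as an
  instance.
* The two-point function is the expectation of the product `⟪s_x, s_y⟫` (outline §0).
* `onSpecification G β Λ η := onMeasure G Λ β (.fixed η)` is a plain `Specification`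
  (outline D3); that it is a specification is the sorried theorem
  `isSpecification_onSpecification`.
* Global `O(N)` symmetry: `ONConfig.rotate R` applies a linear isometry `R` of `ℝ^N` sitewise;
  `onMeasure_free_map_rotate` states invariance of the free-boundary measure on `Λ`-local
  (`cylinderEvents Λ`) events (outside `Λ` the free measure is frozen to the junk reference spin,
  which `R` need not fix).

## Mathlib status

Mathlib has no O(N) / N-vector model. Anchors used verbatim: `Metric.sphere`,
`MeasureTheory.Measure.toSphere` (with its `IsFiniteMeasure` instance and `toSphere_ne_zero`),
`isProbabilityMeasureSMul`, `Measure.pi`, `Measure.map`, `Measure.tilted`,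
`isProbabilityMeasure_tilted`, `LinearIsometryEquiv`, `Sym2.lift`, `inner`.

## References

* S. Friedli, Y. Velenik, *Statistical Mechanics of Lattice Systems* (CUP 2017), Ch. 9
  (models with continuous symmetry), §9.1 (O(N)-symmetric models), §6.2 (specifications).
* B. Simon, *Fifteen problems in mathematical physics*, in Perspectives in Mathematics
  (Birkhäuser 1984), Problem 5 (context).
* H.-O. Georgii, *Gibbs Measures and Phase Transitions*, 2nd ed. (de Gruyter 2011), Ch. 2.
-/

noncomputable section

open MeasureTheory Finset
open scoped RealInnerProductSpace ENNReal

namespace Literature.Probability.LatticeModels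

variable {V : Type*} {N : ℕ}

/-! ### Single-spin space: the unit sphere with its uniform probability measure -/

/-- The single-spin space of the O(N) model: the unit sphere `𝕊^{N-1}` of `ℝ^N`
(`EuclideanSpace ℝ (Fin N)`), as a subtype (Friedli–Velenik 2017, §9.1). Empty for `N = 0`. [cite: FriedliVelenik2017, §9.1] -/
abbrev SphereSpin (N : ℕ) : Type := Metric.sphere (0 : EuclideanSpace ℝ (Fin N)) 1

/-- The uniform probability measure on the unit sphere `𝕊^{N-1}`: Mathlib's
`Measure.toSphere` of Lebesgue measure on `ℝ^N` (the cone measure, a finite rotation-invariant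
measure on the sphere), normalised by its total mass. For `N = 0` the sphere is empty and this is
the zero measure (junk value) (Friedli–Velenik 2017, §9.1, a priori measure of the O(N) model). [cite: FriedliVelenik2017, §9.1  a priori measure of the O(N] -/
def sphereUniform (N : ℕ) : Measure (SphereSpin N) :=
  ((volume : Measure (EuclideanSpace ℝ (Fin N))).toSphere Set.univ)⁻¹ •
    (volume : Measure (EuclideanSpace ℝ (Fin N))).toSphere

/-- For `N ≥ 1` the uniform measure on `𝕊^{N-1}` is a probability measure
(Friedli–Velenik 2017, §9.1). [cite: FriedliVelenik2017, §9.1] -/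
theorem isProbabilityMeasure_sphereUniform (hN : 1 ≤ N) :
    IsProbabilityMeasure (sphereUniform N) := by
  have : Nontrivial (EuclideanSpace ℝ (Fin N)) := by
    have : Nonempty (Fin N) := ⟨⟨0, hN⟩⟩
    infer_instance
  have : NeZero ((volume : Measure (EuclideanSpace ℝ (Fin N))).toSphere) :=
    ⟨Measure.toSphere_ne_zero _⟩
  exact isProbabilityMeasureSMul

/-- For `N ≥ 1` (as a `NeZero N` instance) the uniform measure on `𝕊^{N-1}` is a probability
measure (Friedli–Velenik 2017, §9.1). [cite: FriedliVelenik2017, §9.1] -/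
instance sphereUniform.instIsProbabilityMeasure (N : ℕ) [NeZero N] :
    IsProbabilityMeasure (sphereUniform N) :=
  isProbabilityMeasure_sphereUniform NeZero.one_le

/-- The uniform measure on the sphere is finite (for every `N`; it is `0` for `N = 0`)
(Friedli–Velenik 2017, §9.1). [cite: FriedliVelenik2017, §9.1] -/
instance sphereUniform.instIsFiniteMeasure (N : ℕ) : IsFiniteMeasure (sphereUniform N) := by
  unfold sphereUniform
  set c := (volume : Measure (EuclideanSpace ℝ (Fin N))).toSphere
  by_cases hc : c Set.univ = 0
  · rw [Measure.measure_univ_eq_zero.mp hc, smul_zero]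
    infer_instance
  · exact Measure.smul_finite c (ENNReal.inv_ne_top.mpr hc)

/-! ### Configurations, boundary conditions, gluing -/

/-- Configurations of the O(N) model on the vertex set `V`: a unit vector `s_x ∈ 𝕊^{N-1}` at
every site (Friedli–Velenik 2017, §9.1, `Ω = (𝕊^{N-1})^{V}`). [cite: FriedliVelenik2017, §9.1   Ω = (𝕊^{N-1}] -/
abbrev ONConfig (V : Type*) (N : ℕ) : Type _ := V → SphereSpin N

/-- A boundary condition for the finite-volume O(N) model: `free` (no interaction across the
boundary of `Λ`) or `fixed η` (spins outside `Λ` frozen to `η`) (Friedli–Velenik 2017, §9.1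
with §3.1). [cite: FriedliVelenik2017, §9.1 with §3.1] -/
inductive ONBoundary (V : Type*) (N : ℕ) where
  /-- Free boundary condition (Friedli–Velenik 2017, §3.1/§9.1). -/
  | free : ONBoundary V N
  /-- Boundary condition fixed to `η` outside `Λ` (Friedli–Velenik 2017, §3.1/§9.1). -/
  | fixed (η : ONConfig V N) : ONBoundary V N

/-- The reference spin `e_0 = (1, 0, …, 0) ∈ 𝕊^{N-1}` (`N ≥ 1`), used as the frozen outside value
for the free boundary condition (Friedli–Velenik 2017, §9.1). [cite: FriedliVelenik2017, §9.1] -/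
def SphereSpin.north (N : ℕ) [NeZero N] : SphereSpin N :=
  ⟨EuclideanSpace.single (0 : Fin N) (1 : ℝ), by simp⟩

namespace ONBoundary

/-- The configuration imposed outside `Λ` by a boundary condition: `η` for `fixed η`, and for
`free` the constant junk configuration `SphereSpin.north` — the free Hamiltonian never
evaluates spins outside `Λ`, so this junk value is invisible in `Λ`-local observables
(Friedli–Velenik 2017, §3.1/§9.1). Requires `N ≥ 1` (`ONConfig V 0` is empty for nonempty
`V`). [cite: FriedliVelenik2017, §3.1/§9.1] -/
def outside [NeZero N] : ONBoundary V N → ONConfig V N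
  | free => fun _ => SphereSpin.north N
  | fixed η => η

/-- `outside` of a fixed boundary condition (Friedli–Velenik 2017, §3.1). [cite: FriedliVelenik2017, §3.1] -/
@[simp] theorem outside_fixed [NeZero N] (η : ONConfig V N) : (fixed η).outside = η := rfl

variable (G : SimpleGraph V) [DecidableEq V] [G.LocallyFinite]

/-- The set of interacting edges for the volume `Λ` and boundary condition `bc`: the edges
inside `Λ` (`ℰ_Λ`) for the free boundary condition and the edges touching `Λ` (`ℰ_Λ^b`) for a
fixed one — the same convention as `interactionEdges` for the Ising model
(Friedli–Velenik 2017, §3.1, eqs. (3.2), (3.6); §9.1). [cite: FriedliVelenik2017, §3.1  eqs. (3.2] -/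
def interactionEdges (Λ : Finset V) : ONBoundary V N → Finset (Sym2 V)
  | free => edgesIn G Λ
  | fixed _ => edgesTouching G Λ

/-- `interactionEdges` for the free boundary condition (Friedli–Velenik 2017, §3.1). [cite: FriedliVelenik2017, §3.1] -/
@[simp] theorem interactionEdges_free (Λ : Finset V) :
    interactionEdges G Λ (free : ONBoundary V N) = edgesIn G Λ := rfl

/-- `interactionEdges` for a fixed boundary condition (Friedli–Velenik 2017, §3.1). [cite: FriedliVelenik2017, §3.1] -/
@[simp] theorem interactionEdges_fixed (Λ : Finset V) (η : ONConfig V N) :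
    interactionEdges G Λ (fixed η) = edgesTouching G Λ := rfl

end ONBoundary

/-- Glue a finite configuration `ζ : Λ → 𝕊^{N-1}` inside `Λ` with the boundary condition outside:
`onGlue Λ ζ bc = glueWith Λ ζ bc.outside` (Friedli–Velenik 2017, §6.2/§9.1, `ζ η_{Λᶜ}`). [cite: FriedliVelenik2017, §6.2/§9.1   ζ η_{Λᶜ}] -/
def onGlue [NeZero N] (Λ : Finset V) (ζ : Λ → SphereSpin N) (bc : ONBoundary V N) :
    ONConfig V N :=
  glueWith Λ ζ bc.outside

/-- `ζ ↦ onGlue Λ ζ bc` is measurable for the product σ-algebras, so the push-forward defining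
`onMeasure` carries no `Measure.map` junk (Friedli–Velenik 2017, §6.2). [cite: FriedliVelenik2017, §6.2] -/
@[fun_prop]
theorem measurable_onGlue [NeZero N] (Λ : Finset V) (bc : ONBoundary V N) :
    Measurable fun ζ : Λ → SphereSpin N => onGlue Λ ζ bc :=
  measurable_glueWith Λ bc.outside

/-! ### The Hamiltonian -/

section Hamiltonian

variable (G : SimpleGraph V) [DecidableEq V] [G.LocallyFinite]

/-- The bond observable `⟪s_x, s_y⟫` of an unordered pair `e = s(x, y)`, via `Sym2.lift`
(Friedli–Velenik 2017, eq. (9.2)). [cite: FriedliVelenik2017, eq. (9.2] -/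
def onBond (s : ONConfig V N) : Sym2 V → ℝ :=
  Sym2.lift ⟨fun x y => ⟪(s x : EuclideanSpace ℝ (Fin N)), (s y : EuclideanSpace ℝ (Fin N))⟫,
    fun _ _ => real_inner_comm _ _⟩

omit [DecidableEq V] [G.LocallyFinite] in
/-- `onBond s s(x, y) = ⟪s_x, s_y⟫` (Friedli–Velenik 2017, eq. (9.2)). [cite: FriedliVelenik2017, eq. (9.2] -/
@[simp] theorem onBond_mk (s : ONConfig V N) (x y : V) :
    onBond s s(x, y) = ⟪(s x : EuclideanSpace ℝ (Fin N)), (s y : EuclideanSpace ℝ (Fin N))⟫ :=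
  rfl

omit [DecidableEq V] [G.LocallyFinite] in
/-- `|⟪s_x, s_y⟫| ≤ 1` for unit spins (Cauchy–Schwarz) (Friedli–Velenik 2017, §9.1). [cite: FriedliVelenik2017, §9.1] -/
theorem abs_onBond_le_one (s : ONConfig V N) (e : Sym2 V) : |onBond s e| ≤ 1 := by
  induction e using Sym2.ind with
  | _ x y =>
    rw [onBond_mk]
    refine (abs_real_inner_le_norm _ _).trans ?_
    simp

omit [DecidableEq V] [G.LocallyFinite] in
/-- `s ↦ ⟪s_x, s_y⟫` on a fixed bond is measurable (Friedli–Velenik 2017, §6.2). [cite: FriedliVelenik2017, §6.2] -/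
@[fun_prop]
theorem measurable_onBond (e : Sym2 V) : Measurable fun s : ONConfig V N => onBond s e := by
  induction e using Sym2.ind with
  | _ x y =>
    simp only [onBond_mk]
    exact ((measurable_pi_apply x).subtype_val).inner (measurable_pi_apply y).subtype_val

/-- The finite-volume O(N) Hamiltonian with boundary condition `bc`, in the Friedli–Velenik form
`H_Λ^{bc}(s) = -∑_{{x,y} ∈ ℰ_Λ^{bc}} ⟪s_x, s_y⟫`; boundary spins enter through the edges of
`ℰ_Λ^b` leaving `Λ` (Friedli–Velenik 2017, eq. (9.2) with §3.1). [cite: FriedliVelenik2017, eq. (9.2] -/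
def onHamiltonian (Λ : Finset V) (bc : ONBoundary V N) (s : ONConfig V N) : ℝ :=
  -(∑ e ∈ ONBoundary.interactionEdges G Λ bc, onBond s e)

/-- The Hamiltonian is measurable for the product σ-algebra (Friedli–Velenik 2017, §6.2). [cite: FriedliVelenik2017, §6.2] -/
@[fun_prop]
theorem measurable_onHamiltonian (Λ : Finset V) (bc : ONBoundary V N) :
    Measurable (onHamiltonian G Λ bc) :=
  (Finset.measurable_sum _ fun e _ => measurable_onBond e).neg

/-- `|H_Λ^{bc}(s)| ≤ |ℰ_Λ^{bc}|`: the Hamiltonian is bounded (Friedli–Velenik 2017, §9.1). [cite: FriedliVelenik2017, §9.1] -/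
theorem abs_onHamiltonian_le (Λ : Finset V) (bc : ONBoundary V N) (s : ONConfig V N) :
    |onHamiltonian G Λ bc s| ≤ #(ONBoundary.interactionEdges G Λ bc) := by
  rw [onHamiltonian, abs_neg]
  refine (Finset.abs_sum_le_sum_abs _ _).trans ?_
  calc ∑ e ∈ ONBoundary.interactionEdges G Λ bc, |onBond s e|
      ≤ ∑ _e ∈ ONBoundary.interactionEdges G Λ bc, (1 : ℝ) :=
        Finset.sum_le_sum fun e _ => abs_onBond_le_one s e
    _ = _ := by simp

end Hamiltonian

/-! ### The finite-volume Gibbs measure -/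

section Measure

variable (G : SimpleGraph V) [DecidableEq V] [G.LocallyFinite]

/-- The a priori (reference) measure of the volume `Λ`: the product of uniform sphere measures,
`⊗_{x ∈ Λ} dω(s_x)` on `Λ → 𝕊^{N-1}` (Friedli–Velenik 2017, §9.1 and eq. (6.29)). [cite: FriedliVelenik2017, §9.1 and eq. (6.29] -/
def onReference (N : ℕ) (Λ : Finset V) : Measure (Λ → SphereSpin N) :=
  Measure.pi fun _ => sphereUniform N

/-- The finite-volume O(N) Gibbs measure `μ_{Λ;β}^{bc}` on `ONConfig V N`: the reference product
measure glued with `bc.outside`, pushed to `V → 𝕊^{N-1}` and tilted by the Boltzmann weight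
`exp (-β H_Λ^{bc})` (Mathlib `Measure.tilted`, which includes the normalisation and returns the
junk value `0` if the normaliser is `0` or `∞`) (Friedli–Velenik 2017, §9.1, eq. (9.2) with
eq. (6.29)). [cite: FriedliVelenik2017, §9.1  eq. (9.2] -/
def onMeasure [NeZero N] (Λ : Finset V) (β : ℝ) (bc : ONBoundary V N) :
    Measure (ONConfig V N) :=
  ((onReference N Λ).map (onGlue Λ · bc)).tilted fun s => -β * onHamiltonian G Λ bc s

omit [DecidableEq V] [G.LocallyFinite] in
/-- For `N ≥ 1` the reference product measure is a probability measure
(Friedli–Velenik 2017, §9.1). [cite: FriedliVelenik2017, §9.1] -/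
instance onReference.instIsProbabilityMeasure [NeZero N] (Λ : Finset V) :
    IsProbabilityMeasure (onReference N (Λ := Λ)) :=
  Measure.pi.instIsProbabilityMeasure _

omit [DecidableEq V] [G.LocallyFinite] in
/-- For `N ≥ 1` the glued reference measure on `ONConfig V N` is a probability measure
(`onGlue` is measurable, so `Measure.map` carries no junk) (Friedli–Velenik 2017, §9.1). [cite: FriedliVelenik2017, §9.1] -/
instance isProbabilityMeasure_map_onGlue_onReference [NeZero N] (Λ : Finset V)
    (bc : ONBoundary V N) : IsProbabilityMeasure ((onReference N Λ).map (onGlue Λ · bc)) :=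
  Measure.isProbabilityMeasure_map (measurable_onGlue Λ bc).aemeasurable

/-- The Boltzmann factor `exp (-β H_Λ^{bc})` is integrable against the glued reference measure:
it is measurable and bounded by `exp (|β| |ℰ_Λ^{bc}|)` (Friedli–Velenik 2017, §9.1). [cite: FriedliVelenik2017, §9.1] -/
theorem integrable_exp_onHamiltonian [NeZero N] (Λ : Finset V) (β : ℝ) (bc : ONBoundary V N) :
    Integrable (fun s => Real.exp (-β * onHamiltonian G Λ bc s))
      ((onReference N Λ).map (onGlue Λ · bc)) := by
  have hm : Measurable fun s => Real.exp (-β * onHamiltonian G Λ bc s) :=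
    Real.measurable_exp.comp ((measurable_onHamiltonian G Λ bc).const_mul _)
  refine Integrable.of_bound hm.aestronglyMeasurable
    (Real.exp (|β| * #(ONBoundary.interactionEdges G Λ bc))) (ae_of_all _ fun s => ?_)
  rw [Real.norm_eq_abs, Real.abs_exp]
  refine Real.exp_le_exp.mpr ?_
  calc -β * onHamiltonian G Λ bc s ≤ |-β * onHamiltonian G Λ bc s| := le_abs_self _
    _ = |β| * |onHamiltonian G Λ bc s| := by rw [abs_mul, abs_neg]
    _ ≤ |β| * #(ONBoundary.interactionEdges G Λ bc) :=
        mul_le_mul_of_nonneg_left (abs_onHamiltonian_le G Λ bc s) (abs_nonneg β)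

/-- The finite-volume O(N) measure is a probability measure (`N ≥ 1`): the glued reference
measure is a probability measure and the Boltzmann factor is bounded, so
`isProbabilityMeasure_tilted` applies (Friedli–Velenik 2017, §9.1). [cite: FriedliVelenik2017, §9.1] -/
theorem isProbabilityMeasure_onMeasure [NeZero N] (Λ : Finset V) (β : ℝ) (bc : ONBoundary V N) :
    IsProbabilityMeasure (onMeasure G Λ β bc) :=
  isProbabilityMeasure_tilted (integrable_exp_onHamiltonian G Λ β bc)

/-- The finite-volume O(N) measure is a probability measure, as an instance (real proof,
`isProbabilityMeasure_onMeasure`) (Friedli–Velenik 2017, §9.1). [cite: FriedliVelenik2017, §9.1] -/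
instance onMeasure.instIsProbabilityMeasure [NeZero N] (Λ : Finset V) (β : ℝ)
    (bc : ONBoundary V N) : IsProbabilityMeasure (onMeasure G Λ β bc) :=
  isProbabilityMeasure_onMeasure G Λ β bc

/-- The partition function `Z_{Λ;β}^{bc} = ∫ exp (-β H_Λ^{bc}(s)) ∏_{x∈Λ} dω(s_x)`, the
normaliser of `Measure.tilted` in `onMeasure` (Friedli–Velenik 2017, §9.1 with eq. (6.29)). [cite: FriedliVelenik2017, §9.1 with eq. (6.29] -/
def onPartitionFunction [NeZero N] (Λ : Finset V) (β : ℝ) (bc : ONBoundary V N) : ℝ :=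
  ∫ s, Real.exp (-β * onHamiltonian G Λ bc s) ∂(onReference N Λ).map (onGlue Λ · bc)

/-- The partition function is positive for `N ≥ 1` (Friedli–Velenik 2017, §9.1). [cite: FriedliVelenik2017, §9.1] -/
theorem onPartitionFunction_pos [NeZero N] (Λ : Finset V) (β : ℝ) (bc : ONBoundary V N) :
    0 < onPartitionFunction G Λ β bc :=
  integral_exp_pos (integrable_exp_onHamiltonian G Λ β bc)

end Measure

/-! ### Two-point function -/

/-- The two-point function `⟨s_x · s_y⟩_μ = ∫ ⟪s_x, s_y⟫ dμ` of a measure on O(N)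
configurations, an expectation of a product (so `= 1` on the diagonal for a probability
measure) (Friedli–Velenik 2017, §9.1; Simon 1984, Problem 5). [cite: FriedliVelenik2017, §9.1] -/
def onTwoPoint (μ : Measure (ONConfig V N)) (x y : V) : ℝ :=
  ∫ s, ⟪(s x : EuclideanSpace ℝ (Fin N)), (s y : EuclideanSpace ℝ (Fin N))⟫ ∂μ

/-- `onTwoPoint μ x y = ∫ onBond s s(x, y) dμ` (Friedli–Velenik 2017, §9.1). [cite: FriedliVelenik2017, §9.1] -/
theorem onTwoPoint_eq_integral_onBond (μ : Measure (ONConfig V N)) (x y : V) :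
    onTwoPoint μ x y = ∫ s, onBond s s(x, y) ∂μ := rfl

/-- The diagonal of the two-point function of a probability measure is `1`
(Friedli–Velenik 2017, §9.1). [cite: FriedliVelenik2017, §9.1] -/
@[simp] theorem onTwoPoint_self (μ : Measure (ONConfig V N)) [IsProbabilityMeasure μ] (x : V) :
    onTwoPoint μ x x = 1 := by
  simp [onTwoPoint]

/-- `|⟨s_x · s_y⟩_μ| ≤ 1` for a probability measure (Friedli–Velenik 2017, §9.1). [cite: FriedliVelenik2017, §9.1] -/
theorem abs_onTwoPoint_le_one (μ : Measure (ONConfig V N)) [IsProbabilityMeasure μ] (x y : V) :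
    |onTwoPoint μ x y| ≤ 1 := by
  rw [onTwoPoint_eq_integral_onBond]
  refine (abs_integral_le_integral_abs).trans ?_
  calc ∫ s, |onBond s s(x, y)| ∂μ ≤ ∫ _s, (1 : ℝ) ∂μ := by
        refine integral_mono_of_nonneg (ae_of_all _ fun _ => abs_nonneg _) (integrable_const _)
          (ae_of_all _ fun s => abs_onBond_le_one s _)
    _ = 1 := by simp

/-! ### The O(N) specification and infinite-volume Gibbs measures -/

section Specification

variable (G : SimpleGraph V) [DecidableEq V] [G.LocallyFinite]

/-- The O(N) specification of the graph `G` at inverse temperature `β`: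
`γ_Λ(· | η) = μ_{Λ;β}^η`, the finite-volume measure with boundary condition fixed to `η`
(Friedli–Velenik 2017, §6.2 (eq. (6.29)) and §9.1; Georgii 2011, Def. 2.9). [cite: FriedliVelenik2017, §6.2 (eq. (6.29] -/
def onSpecification [NeZero N] (β : ℝ) : Specification V (SphereSpin N) :=
  fun Λ η => onMeasure G Λ β (.fixed η)

/-- `onSpecification G β Λ η` is the fixed-boundary O(N) measure (Friedli–Velenik 2017, §9.1). [cite: FriedliVelenik2017, §9.1] -/
@[simp] theorem onSpecification_apply [NeZero N] (β : ℝ) (Λ : Finset V) (η : ONConfig V N) :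
    onSpecification G β Λ η = onMeasure G Λ β (.fixed η) := rfl

/-- The O(N) kernels form a specification: probability, `𝓕_{Λᶜ}`-measurability in the boundary
condition, properness and consistency (Friedli–Velenik 2017, Lemma 6.20 / §6.10 for compact spin
spaces; Georgii 2011, Prop. 2.5 with Def. 2.9). [cite: FriedliVelenik2017, Lemma 6.20 / §6.10 for compact spin spac] -/
def isSpecification_onSpecification : Prop :=
  ∀ [NeZero N] (β : ℝ),
    IsSpecification (onSpecification (N := N) G β)

end Specification

/-- The set of infinite-volume Gibbs measures of the O(N) model on `ℤ^d` at inverse temperature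
`β`: `𝒢(γ^{O(N)}_{ℤ^d, β})` (Friedli–Velenik 2017, Def. 6.13 and §9.1). [cite: FriedliVelenik2017, Def. 6.13 and §9.1] -/
def onGibbsMeasures (d N : ℕ) [NeZero N] (β : ℝ) : Set (Measure (ONConfig (Site d) N)) :=
  gibbsMeasures (onSpecification (zdGraph d) β)

/-- Membership in `onGibbsMeasures` is the DLR condition for the O(N) specification on `ℤ^d`
(Friedli–Velenik 2017, Def. 6.13). [cite: FriedliVelenik2017, Def. 6.13] -/
theorem mem_onGibbsMeasures_iff (d N : ℕ) [NeZero N] (β : ℝ)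
    (μ : Measure (ONConfig (Site d) N)) :
    μ ∈ onGibbsMeasures d N β ↔ IsGibbsMeasure (onSpecification (zdGraph d) β) μ :=
  Iff.rfl

/-! ### Global O(N) symmetry -/

/-- The sitewise action of a linear isometry `R ∈ O(N)` of `ℝ^N` on configurations:
`(rotate R s)_x = R (s_x)`; `R` preserves the unit sphere (Friedli–Velenik 2017, §9.1, global
`O(N)` symmetry). [cite: FriedliVelenik2017, §9.1  global  O(N] -/
def ONConfig.rotate (R : EuclideanSpace ℝ (Fin N) ≃ₗᵢ[ℝ] EuclideanSpace ℝ (Fin N))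
    (s : ONConfig V N) : ONConfig V N :=
  fun x => ⟨R (s x), by simp [R.norm_map]⟩

/-- `(rotate R s) x = R (s x)` as vectors (Friedli–Velenik 2017, §9.1). [cite: FriedliVelenik2017, §9.1] -/
@[simp] theorem ONConfig.coe_rotate_apply
    (R : EuclideanSpace ℝ (Fin N) ≃ₗᵢ[ℝ] EuclideanSpace ℝ (Fin N)) (s : ONConfig V N) (x : V) :
    ((ONConfig.rotate R s x : SphereSpin N) : EuclideanSpace ℝ (Fin N)) = R (s x) := rfl

/-- The Hamiltonian is `O(N)`-invariant: `⟪R s_x, R s_y⟫ = ⟪s_x, s_y⟫`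
(Friedli–Velenik 2017, §9.1). [cite: FriedliVelenik2017, §9.1] -/
theorem onBond_rotate (R : EuclideanSpace ℝ (Fin N) ≃ₗᵢ[ℝ] EuclideanSpace ℝ (Fin N))
    (s : ONConfig V N) (e : Sym2 V) : onBond (ONConfig.rotate R s) e = onBond s e := by
  induction e using Sym2.ind with
  | _ x y => simp [onBond_mk, LinearIsometryEquiv.inner_map_map]

/-- `s ↦ rotate R s` is measurable (Friedli–Velenik 2017, §9.1). [cite: FriedliVelenik2017, §9.1] -/
theorem ONConfig.measurable_rotate
    (R : EuclideanSpace ℝ (Fin N) ≃ₗᵢ[ℝ] EuclideanSpace ℝ (Fin N)) :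
    Measurable (ONConfig.rotate (V := V) R) := by
  refine measurable_pi_lambda _ fun x => ?_
  exact (R.continuous.measurable.comp (measurable_pi_apply x).subtype_val).subtype_mk

/-- Global `O(N)` invariance of the free-boundary finite-volume measure: the push-forward of
`μ_{Λ;β}^{free}` under the sitewise rotation `R` is `μ_{Λ;β}^{free}` composed with the rotation
of the (junk) outside reference spin; restricted to `Λ`-local events it is literally invariant.
We state the clean form on events depending only on spins in `Λ`
(Friedli–Velenik 2017, §9.1, `O(N)` symmetry of the Gibbs measure). [cite: FriedliVelenik2017, §9.1   O(N] -/
def onMeasure_free_map_rotate : Prop :=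
  ∀ [NeZero N] (G : SimpleGraph V) [DecidableEq V] [G.LocallyFinite] (Λ : Finset V) (β : ℝ) (R : EuclideanSpace ℝ (Fin N) ≃ₗᵢ[ℝ] EuclideanSpace ℝ (Fin N)) {A : Set (ONConfig V N)} (hA : MeasurableSet[cylinderEvents (↑Λ : Set V)] A),
    (onMeasure G Λ β .free).map (ONConfig.rotate R) A = onMeasure G Λ β .free A

end Literature.Probability.LatticeModels
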